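import Summits.Schanuel.Schanuel.Theorems.RootDecomp1KMeasuredWallCell02

/-!
# RootDecomp1KMeasuredWallCell — lens 1, generation 38 «MEASURED WALL CELL of 33364» (the mixed wall (1, ℓ₂, ℓ₃, ρ) for every ρ in the tree class LogHyperLiouville) — continuation (RootDecomp1KMeasuredWallCell03): §4 block tools (section `BlockTools`)

(lens-1 g38 `RootDecomp1KMeasuredWallCell.lean` [HOME/decomp-schanuel-lens-1/g38/RootDecomp1KMeasuredWallCell.lean sha256 168ec8e8…3303, 1895 l + MWprobe 0edab326… + MWctrl b192be9d… + NODE-g38.md 03a7462f…; NOTE/CLAIM L1764, ACK + CHECKLIST K-g38 L1782, NODE L1785 / REQUEST L1786 / RESULT L1787; writer re-check L1790]; port by census-1 gen 16 in seven parts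
`RootDecomp1KMeasuredWallCell01`–`07` — see the PORT NOTE of part 01; `--supports stmt-Schanuel-33364`; rung 0.)
-/

noncomputable section

open Complex IntermediateField Polynomial
open Summit.Schanuel.Schanuel.Theorems.RootDecomp1KHyper
open Summit.Schanuel.Schanuel.Theorems.RootDecomp1KHyper.HyperCell
open Summit.Schanuel.Schanuel.Theorems.RootDecomp1KGeneric
open Summit.Schanuel.Schanuel.Theorems.RootDecomp1KRelLiouvilleCell
open Summit.Schanuel.Schanuel.Theorems.RootDecomp1KLogLogCell (LogLogLiouville logLogLiouville_of_logHyperLiouville)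
open Summit.Schanuel.Schanuel.Theorems.RootDecomp1KTwoBaseCell

namespace Summit.Schanuel.Schanuel.Theorems.RootDecomp1KMeasuredWallCell

open LiouvilleNumber
open scoped Nat

/-! ## §4  (M) THE BLOCK MEASURE: `MvPolyMeasure θ ⇒ LogPowMeasure (ℓ₂, ℓ₃, θ)`, explicit exponent `d + 3` -/

section BlockTools
open LiouvilleNumber
open scoped Nat

variable {n : ℕ}

/-- `mvlen (c·X^m) ≤ |c|`. -/
private theorem mvlen_monomial_le' (m : Fin n →₀ ℕ) (c : ℤ) :
    mvlen (MvPolynomial.monomial m c) ≤ |c| := by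
  classical
  rw [mvlen_eq_sum_of_support_subset _ MvPolynomial.support_monomial_subset, Finset.sum_singleton,
    MvPolynomial.coeff_monomial, if_pos rfl]

/-- Subadditivity of `mvlen`. -/
private theorem mvlen_add_le' (P Q : MvPolynomial (Fin n) ℤ) : mvlen (P + Q) ≤ mvlen P + mvlen Q := by
  classical
  have hs : (P + Q).support ⊆ P.support ∪ Q.support := MvPolynomial.support_add
  rw [mvlen_eq_sum_of_support_subset _ hs,
    mvlen_eq_sum_of_support_subset P (Finset.subset_union_left (s₂ := Q.support)),
    mvlen_eq_sum_of_support_subset Q (Finset.subset_union_right (s₁ := P.support)),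
    ← Finset.sum_add_distrib]
  exact Finset.sum_le_sum fun m _ => by rw [MvPolynomial.coeff_add]; exact abs_add_le _ _

/-- `mvlen (Σ F_i) ≤ Σ mvlen F_i`. -/
private theorem mvlen_sum_le' {ι : Type*} (s : Finset ι) (F : ι → MvPolynomial (Fin n) ℤ) :
    mvlen (∑ i ∈ s, F i) ≤ ∑ i ∈ s, mvlen (F i) := by
  classical
  induction s using Finset.induction_on with
  | empty => simp [mvlen]
  | insert a s ha ih =>
    rw [Finset.sum_insert ha, Finset.sum_insert ha]
    exact (mvlen_add_le' _ _).trans (by linarith)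

/-- Upper bound for the tail in base `m ≥ 2`: `r_k ≤ 2·m^{-(k+1)!}`. -/
private theorem remainder_le' {m : ℝ} (hm : 2 ≤ m) (k : ℕ) : remainder m k ≤ 2 / m ^ (k + 1)! := by
  have m1 : (1 : ℝ) < m := by linarith
  have h := remainder_lt' k m1
  have hhalf : (1 : ℝ) / m ≤ 1 / 2 := one_div_le_one_div_of_le two_pos hm
  have hpos : (0 : ℝ) < 1 - 1 / m := by linarith
  have hinv : (1 - 1 / m)⁻¹ ≤ 2 := by
    rw [inv_le_comm₀ hpos two_pos]
    linarith
  have hmk : (0 : ℝ) < 1 / m ^ (k + 1)! := by positivity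
  calc remainder m k ≤ (1 - 1 / m)⁻¹ * (1 / m ^ (k + 1)!) := h.le
    _ ≤ 2 * (1 / m ^ (k + 1)!) := mul_le_mul_of_nonneg_right hinv hmk.le
    _ = 2 / m ^ (k + 1)! := by ring

/-- `|ℓ_m − s_K| ≤ 2·2^{−(K+1)!}` in every base `m ≥ 2`. -/
theorem abs_liouvilleNumber_sub_partialSum_le {m : ℝ} (hm : 2 ≤ m) (K : ℕ) :
    |liouvilleNumber m - partialSum m K| ≤ 2 / 2 ^ (K + 1)! := by
  have m1 : (1 : ℝ) < m := by linarith
  rw [← partialSum_add_remainder m1 K, add_sub_cancel_left, abs_of_pos (remainder_pos m1 K)]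
  refine (remainder_le' hm K).trans ?_
  gcongr

/-- `0 < s_K < ℓ_m`. -/
theorem partialSum_pos_lt {m : ℝ} (hm : 1 < m) (K : ℕ) :
    0 < partialSum m K ∧ partialSum m K < liouvilleNumber m := by
  have m0 : 0 < m := by linarith
  refine ⟨?_, ?_⟩
  · unfold partialSum
    exact Finset.sum_pos (fun i _ => by positivity) ⟨0, by simp⟩
  · have := partialSum_add_remainder hm K
    have hr := remainder_pos hm K
    linarith

/-- Exponents of a support monomial are bounded by the total degree. -/
theorem apply_le_of_mem_support {σ : Type*} {P : MvPolynomial σ ℤ} {d : ℕ}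
    (hdeg : P.totalDegree ≤ d) {e : σ →₀ ℕ} (he : e ∈ P.support) (i : σ) : e i ≤ d :=
  (MvPolynomial.monomial_le_degreeOf i he).trans ((MvPolynomial.degreeOf_le_totalDegree P i).trans hdeg)

/-- Evaluation of `P ∈ ℤ[X₀, X₁, X₂…]` at `(y, x, θ)` as a support sum. -/
theorem mvaeval_cons_cons_eq_sum (P : MvPolynomial (Fin (n + 2)) ℤ) (θ : Fin n → ℂ) (y x : ℂ) :
    MvPolynomial.aeval (Fin.cons y (Fin.cons x θ) : Fin (n + 2) → ℂ) P =
      ∑ e ∈ P.support, ((P.coeff e : ℤ) : ℂ) * (y ^ e 0 * (x ^ e (Fin.succ 0) *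
        ∏ j : Fin n, θ j ^ e j.succ.succ)) := by
  rw [MvPolynomial.aeval_def, MvPolynomial.eval₂_eq']
  refine Finset.sum_congr rfl fun e _ => ?_
  rw [algebraMap_int_eq, eq_intCast, Fin.prod_univ_succ, Fin.prod_univ_succ]
  simp only [Fin.cons_zero, Fin.cons_succ]

/-- **The window specialisation** `H = Σ_e p_e · a₂^{e₀} q₂^{d−e₀} a₃^{e₁} q₃^{d−e₁} · X^{tail² e} ∈ ℤ[X⃗]`
(`= (q₂q₃)^d · P(a₂/q₂, a₃/q₃, X⃗)`). -/
def wspec (P : MvPolynomial (Fin (n + 2)) ℤ) (d : ℕ) (a₂ a₃ : ℤ) (q₂ q₃ : ℕ) : MvPolynomial (Fin n) ℤ :=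
  ∑ e ∈ P.support, MvPolynomial.monomial (Finsupp.tail (Finsupp.tail e))
    (P.coeff e * (a₂ ^ e 0 * (q₂ : ℤ) ^ (d - e 0) *
      (a₃ ^ e (Fin.succ 0) * (q₃ : ℤ) ^ (d - e (Fin.succ 0)))))

/-- `H(θ) = (q₂ q₃)^d · P(a₂/q₂, a₃/q₃, θ)`. -/
theorem mvaeval_wspec (P : MvPolynomial (Fin (n + 2)) ℤ) {d : ℕ} (hdeg : P.totalDegree ≤ d)
    (a₂ a₃ : ℤ) {q₂ q₃ : ℕ} (hq₂ : q₂ ≠ 0) (hq₃ : q₃ ≠ 0) (θ : Fin n → ℂ) :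
    MvPolynomial.aeval θ (wspec P d a₂ a₃ q₂ q₃) =
      ((q₂ : ℂ) * q₃) ^ d * MvPolynomial.aeval
        (Fin.cons ((a₂ : ℂ) / q₂) (Fin.cons ((a₃ : ℂ) / q₃) θ) : Fin (n + 2) → ℂ) P := by
  unfold wspec
  rw [map_sum, mvaeval_cons_cons_eq_sum, Finset.mul_sum]
  refine Finset.sum_congr rfl fun e he => ?_
  have h0 : e 0 ≤ d := apply_le_of_mem_support hdeg he 0
  have h1 : e (Fin.succ 0) ≤ d := apply_le_of_mem_support hdeg he _
  rw [MvPolynomial.aeval_monomial, algebraMap_int_eq, eq_intCast, Finsupp.prod_pow]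
  simp only [Finsupp.tail_apply]
  push_cast
  have hq₂C : (q₂ : ℂ) ≠ 0 := by exact_mod_cast hq₂
  have hq₃C : (q₃ : ℂ) ≠ 0 := by exact_mod_cast hq₃
  have hq2d : (q₂ : ℂ) ^ d = (q₂ : ℂ) ^ e 0 * (q₂ : ℂ) ^ (d - e 0) := by
    rw [← pow_add, Nat.add_sub_cancel' h0]
  have hq3d : (q₃ : ℂ) ^ d = (q₃ : ℂ) ^ e (Fin.succ 0) * (q₃ : ℂ) ^ (d - e (Fin.succ 0)) := by
    rw [← pow_add, Nat.add_sub_cancel' h1]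
  rw [mul_pow, hq2d, hq3d, div_pow, div_pow]
  field_simp

/-- `totalDegree H ≤ d`. -/
theorem totalDegree_wspec_le (P : MvPolynomial (Fin (n + 2)) ℤ) {d : ℕ} (hdeg : P.totalDegree ≤ d)
    (a₂ a₃ : ℤ) (q₂ q₃ : ℕ) : (wspec P d a₂ a₃ q₂ q₃).totalDegree ≤ d := by
  classical
  unfold wspec
  refine (MvPolynomial.totalDegree_finsetSum _ _).trans (Finset.sup_le fun e he => ?_)
  refine (MvPolynomial.totalDegree_monomial_le _ _).trans ?_
  have h1 := MvPolynomial.le_totalDegree he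
  rw [Finsupp.sum_fintype _ _ (fun _ => rfl)] at h1 ⊢
  simp only [Finsupp.tail_apply, id]
  rw [Fin.sum_univ_succ, Fin.sum_univ_succ] at h1
  have := h1.trans hdeg
  omega

/-- `mvlen H ≤ (A₂ A₃)^d · mvlen P` when `|a₂|, q₂ ≤ A₂` and `|a₃|, q₃ ≤ A₃`. -/
theorem mvlen_wspec_le (P : MvPolynomial (Fin (n + 2)) ℤ) {d : ℕ} (hdeg : P.totalDegree ≤ d)
    {a₂ a₃ : ℤ} {q₂ q₃ : ℕ} {A₂ A₃ : ℤ} (ha₂ : |a₂| ≤ A₂) (hq₂ : (q₂ : ℤ) ≤ A₂)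
    (ha₃ : |a₃| ≤ A₃) (hq₃ : (q₃ : ℤ) ≤ A₃) :
    mvlen (wspec P d a₂ a₃ q₂ q₃) ≤ (A₂ * A₃) ^ d * mvlen P := by
  classical
  have hA₂ : 0 ≤ A₂ := (abs_nonneg _).trans ha₂
  have hA₃ : 0 ≤ A₃ := (abs_nonneg _).trans ha₃
  unfold wspec
  refine (mvlen_sum_le' _ _).trans ?_
  have hR : mvlen P = ∑ e ∈ P.support, |P.coeff e| := rfl
  rw [hR, Finset.mul_sum]
  refine Finset.sum_le_sum fun e he => (mvlen_monomial_le' _ _).trans ?_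
  have h0 : e 0 ≤ d := apply_le_of_mem_support hdeg he 0
  have h1 : e (Fin.succ 0) ≤ d := apply_le_of_mem_support hdeg he _
  rw [abs_mul, mul_comm]
  refine mul_le_mul_of_nonneg_right ?_ (abs_nonneg _)
  rw [abs_mul, abs_mul, abs_mul, abs_pow, abs_pow, abs_pow, abs_pow, Nat.abs_cast, Nat.abs_cast]
  calc |a₂| ^ e 0 * (q₂ : ℤ) ^ (d - e 0) * (|a₃| ^ e (Fin.succ 0) * (q₃ : ℤ) ^ (d - e (Fin.succ 0)))
      ≤ A₂ ^ e 0 * A₂ ^ (d - e 0) * (A₃ ^ e (Fin.succ 0) * A₃ ^ (d - e (Fin.succ 0))) := by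
        gcongr
    _ = (A₂ * A₃) ^ d := by
        rw [← pow_add, ← pow_add, Nat.add_sub_cancel' h0, Nat.add_sub_cancel' h1, mul_pow]

/-- The coefficient of `H` at `α`. -/
theorem coeff_wspec (P : MvPolynomial (Fin (n + 2)) ℤ) (d : ℕ) (a₂ a₃ : ℤ) (q₂ q₃ : ℕ)
    (α : Fin n →₀ ℕ) :
    (wspec P d a₂ a₃ q₂ q₃).coeff α =
      ∑ e ∈ P.support.filter (fun e => Finsupp.tail (Finsupp.tail e) = α),
        P.coeff e * (a₂ ^ e 0 * (q₂ : ℤ) ^ (d - e 0) *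
          (a₃ ^ e (Fin.succ 0) * (q₃ : ℤ) ^ (d - e (Fin.succ 0)))) := by
  classical
  unfold wspec
  rw [MvPolynomial.coeff_sum, Finset.sum_filter]
  refine Finset.sum_congr rfl fun e _ => ?_
  rw [MvPolynomial.coeff_monomial]

/-- **The `(y, x)`-slice of `P` at the tail exponent `α`:** `F_α = Σ_{tail² e = α} p_e x^{e₁} y^{e₀} ∈ ℤ[x][y]`. -/
def sliceXY (P : MvPolynomial (Fin (n + 2)) ℤ) (α : Fin n →₀ ℕ) : ℤ[X][X] :=
  ∑ e ∈ P.support.filter (fun e => Finsupp.tail (Finsupp.tail e) = α),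
    Polynomial.monomial (e 0) (Polynomial.monomial (e (Fin.succ 0)) (P.coeff e))

/-- `F_α(y₀, x₀)` as a support sum. -/
theorem evxy_sliceXY (P : MvPolynomial (Fin (n + 2)) ℤ) (α : Fin n →₀ ℕ) (x₀ y₀ : ℚ) :
    evxy x₀ y₀ (sliceXY P α) =
      ∑ e ∈ P.support.filter (fun e => Finsupp.tail (Finsupp.tail e) = α),
        ((P.coeff e : ℤ) : ℚ) * (y₀ ^ e 0 * x₀ ^ e (Fin.succ 0)) := by
  unfold evxy sliceXY
  rw [Polynomial.eval_map, Polynomial.eval₂_finsetSum]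
  refine Finset.sum_congr rfl fun e _ => ?_
  rw [Polynomial.eval₂_monomial]
  simp only [AlgHom.toRingHom_eq_coe, RingHom.coe_coe, Polynomial.aeval_monomial, algebraMap_int_eq,
    eq_intCast]
  ring

/-- `coeff_α(H) = (q₂ q₃)^d · F_α(a₂/q₂, a₃/q₃)` (as rationals). -/
theorem coeff_wspec_eq (P : MvPolynomial (Fin (n + 2)) ℤ) {d : ℕ} (hdeg : P.totalDegree ≤ d)
    (a₂ a₃ : ℤ) {q₂ q₃ : ℕ} (hq₂ : q₂ ≠ 0) (hq₃ : q₃ ≠ 0) (α : Fin n →₀ ℕ) :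
    (((wspec P d a₂ a₃ q₂ q₃).coeff α : ℤ) : ℚ) =
      ((q₂ : ℚ) * q₃) ^ d * evxy ((a₃ : ℚ) / q₃) ((a₂ : ℚ) / q₂) (sliceXY P α) := by
  rw [coeff_wspec, evxy_sliceXY, Finset.mul_sum]
  push_cast
  refine Finset.sum_congr rfl fun e he => ?_
  have he' := (Finset.mem_filter.mp he).1
  have h0 : e 0 ≤ d := apply_le_of_mem_support hdeg he' 0
  have h1 : e (Fin.succ 0) ≤ d := apply_le_of_mem_support hdeg he' _
  have hq₂Q : (q₂ : ℚ) ≠ 0 := by exact_mod_cast hq₂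
  have hq₃Q : (q₃ : ℚ) ≠ 0 := by exact_mod_cast hq₃
  have hq2d : (q₂ : ℚ) ^ d = (q₂ : ℚ) ^ e 0 * (q₂ : ℚ) ^ (d - e 0) := by
    rw [← pow_add, Nat.add_sub_cancel' h0]
  have hq3d : (q₃ : ℚ) ^ d = (q₃ : ℚ) ^ e (Fin.succ 0) * (q₃ : ℚ) ^ (d - e (Fin.succ 0)) := by
    rw [← pow_add, Nat.add_sub_cancel' h1]
  rw [mul_pow, hq2d, hq3d, div_pow, div_pow]
  field_simp

/-- `H ≠ 0` as soon as one slice does not vanish at the point. -/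
theorem wspec_ne_zero (P : MvPolynomial (Fin (n + 2)) ℤ) {d : ℕ} (hdeg : P.totalDegree ≤ d)
    (a₂ a₃ : ℤ) {q₂ q₃ : ℕ} (hq₂ : q₂ ≠ 0) (hq₃ : q₃ ≠ 0) {α : Fin n →₀ ℕ}
    (hF : evxy ((a₃ : ℚ) / q₃) ((a₂ : ℚ) / q₂) (sliceXY P α) ≠ 0) :
    wspec P d a₂ a₃ q₂ q₃ ≠ 0 := by
  intro hH
  have h1 := coeff_wspec_eq P hdeg a₂ a₃ hq₂ hq₃ α
  rw [hH, MvPolynomial.coeff_zero, Int.cast_zero] at h1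
  have hq : ((q₂ : ℚ) * q₃) ^ d ≠ 0 := by positivity
  exact hF ((mul_eq_zero.mp h1.symm).resolve_left hq)

/-- The double coefficients of a slice. -/
theorem coeff_coeff_sliceXY (P : MvPolynomial (Fin (n + 2)) ℤ) (α : Fin n →₀ ℕ) (i j : ℕ) :
    ((sliceXY P α).coeff i).coeff j =
      ∑ e ∈ P.support.filter (fun e => Finsupp.tail (Finsupp.tail e) = α),
        if e 0 = i ∧ e (Fin.succ 0) = j then P.coeff e else 0 := by
  classical
  unfold sliceXY
  rw [Polynomial.finsetSum_coeff, Polynomial.finsetSum_coeff]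
  refine Finset.sum_congr rfl fun e _ => ?_
  by_cases h0 : e 0 = i
  · by_cases h1 : e (Fin.succ 0) = j
    · rw [if_pos ⟨h0, h1⟩, Polynomial.coeff_monomial, if_pos h0, Polynomial.coeff_monomial, if_pos h1]
    · rw [if_neg (fun h => h1 h.2), Polynomial.coeff_monomial, if_pos h0, Polynomial.coeff_monomial,
        if_neg h1]
  · rw [if_neg (fun h => h0 h.1), Polynomial.coeff_monomial, if_neg h0, Polynomial.coeff_zero]

/-- A monomial exponent is recovered from `e₀, e₁` and `tail² e`. -/
theorem finsupp_eq_of_parts {e e' : Fin (n + 2) →₀ ℕ} (h0 : e 0 = e' 0)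
    (h1 : e (Fin.succ 0) = e' (Fin.succ 0))
    (ht : Finsupp.tail (Finsupp.tail e) = Finsupp.tail (Finsupp.tail e')) : e = e' := by
  have ht1 : Finsupp.tail e = Finsupp.tail e' := by
    rw [← Finsupp.cons_tail (Finsupp.tail e), ← Finsupp.cons_tail (Finsupp.tail e'), ht,
      Finsupp.tail_apply, Finsupp.tail_apply, h1]
  rw [← Finsupp.cons_tail e, ← Finsupp.cons_tail e', ht1, h0]

/-- **The slice at a support exponent is non-zero.** -/
theorem sliceXY_ne_zero (P : MvPolynomial (Fin (n + 2)) ℤ) {e₀ : Fin (n + 2) →₀ ℕ}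
    (he₀ : e₀ ∈ P.support) : sliceXY P (Finsupp.tail (Finsupp.tail e₀)) ≠ 0 := by
  classical
  intro h
  have hc := congrArg (fun F : ℤ[X][X] => (F.coeff (e₀ 0)).coeff (e₀ (Fin.succ 0))) h
  simp only [Polynomial.coeff_zero] at hc
  have hmem : e₀ ∈ P.support.filter
      (fun e => Finsupp.tail (Finsupp.tail e) = Finsupp.tail (Finsupp.tail e₀)) :=
    Finset.mem_filter.mpr ⟨he₀, rfl⟩
  have hzero : ∀ e ∈ P.support.filter
      (fun e => Finsupp.tail (Finsupp.tail e) = Finsupp.tail (Finsupp.tail e₀)), e ≠ e₀ →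
      (if e 0 = e₀ 0 ∧ e (Fin.succ 0) = e₀ (Fin.succ 0) then P.coeff e else 0) = 0 := by
    intro e he hne
    rw [if_neg]
    rintro ⟨h0, h1⟩
    exact hne (finsupp_eq_of_parts h0 h1 (Finset.mem_filter.mp he).2)
  rw [coeff_coeff_sliceXY, Finset.sum_eq_single_of_mem e₀ hmem hzero] at hc
  simp only [and_self, if_true] at hc
  exact (MvPolynomial.mem_support_iff.mp he₀) hc

/-- `deg_y F_α ≤ d`. -/
theorem natDegree_sliceXY_le (P : MvPolynomial (Fin (n + 2)) ℤ) {d : ℕ} (hdeg : P.totalDegree ≤ d)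
    (α : Fin n →₀ ℕ) : (sliceXY P α).natDegree ≤ d := by
  unfold sliceXY
  refine Polynomial.natDegree_sum_le_of_forall_le _ _ fun e he => ?_
  exact (Polynomial.natDegree_monomial_le _).trans
    (apply_le_of_mem_support hdeg (Finset.mem_filter.mp he).1 0)

/-- `deg_x` of every `y`-coefficient of `F_α` is `≤ d`. -/
theorem natDegree_coeff_sliceXY_le (P : MvPolynomial (Fin (n + 2)) ℤ) {d : ℕ}
    (hdeg : P.totalDegree ≤ d) (α : Fin n →₀ ℕ) (i : ℕ) :
    ((sliceXY P α).coeff i).natDegree ≤ d := by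
  classical
  unfold sliceXY
  rw [Polynomial.finsetSum_coeff]
  refine Polynomial.natDegree_sum_le_of_forall_le _ _ fun e he => ?_
  rw [Polynomial.coeff_monomial]
  split_ifs
  · exact (Polynomial.natDegree_monomial_le _).trans
      (apply_le_of_mem_support hdeg (Finset.mem_filter.mp he).1 _)
  · simp

/-- Every coefficient of `F_α` is bounded by `mvlen P`. -/
theorem abs_coeff_coeff_sliceXY_le (P : MvPolynomial (Fin (n + 2)) ℤ) (α : Fin n →₀ ℕ) (i j : ℕ) :
    |((sliceXY P α).coeff i).coeff j| ≤ mvlen P := by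
  classical
  rw [coeff_coeff_sliceXY]
  refine (Finset.abs_sum_le_sum_abs _ _).trans ?_
  have hR : mvlen P = ∑ e ∈ P.support, |P.coeff e| := rfl
  rw [hR]
  refine (Finset.sum_le_sum fun e _ => ?_).trans
    (Finset.sum_le_sum_of_subset_of_nonneg (Finset.filter_subset _ _) fun _ _ _ => abs_nonneg _)
  split_ifs <;> simp

end BlockTools

end Summit.Schanuel.Schanuel.Theorems.RootDecomp1KMeasuredWallCell

end
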